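import Mathlib
import Summits.Ventures.PercRepro2.Defs
import Summits.Ventures.PercRepro2.Independence
import Summits.Ventures.PercRepro2.Graph

/-!
# Finite bond percolation — exploration of a cluster (blind cell PercRepro2, typer-1)

The exploration-process view of `{C(v) = S}`:

* `restrict F ω` keeps only the edges of `F` open;
* `clusterEvent_eq`: `{C(v) = S} = {S internally connected from v} ∩ {∂S closed}`,
  the two factors being determined by the disjoint edge sets `within S` and `boundary S`;
* `prob_clusterEvent_eq_mul`: hence `P(C(v) = S) = P(S internally connected from v) · ∏_{e ∈ ∂S} (1 - p e)`;
* `conn_restrict_iff_of_cluster_eq`: on `{C(v) = S}`, for `u ∉ S` the connections of `u` are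
  those of the graph with the edges touching `S` removed — the spatial Markov property in the
  form used by exploration arguments — and `prob_clusterEvent_inter_connEvent` is its
  probabilistic form.
-/

namespace Summit.Ventures.PercRepro2

section Restrict

variable {E : Type*}

/-- The configuration `ω` with every edge outside `F` closed. -/
def restrict (F : Set E) [DecidablePred (· ∈ F)] (ω : Config E) : Config E :=
  fun e => ω e && decide (e ∈ F)

/-- `restrict` on an edge of `F`. -/
lemma restrict_apply_of_mem {F : Set E} [DecidablePred (· ∈ F)] {ω : Config E} {e : E}
    (h : e ∈ F) : restrict F ω e = ω e := by
  simp [restrict, h]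

/-- `restrict` on an edge outside `F`. -/
lemma restrict_apply_of_notMem {F : Set E} [DecidablePred (· ∈ F)] {ω : Config E} {e : E}
    (h : e ∉ F) : restrict F ω e = false := by
  simp [restrict, h]

/-- An edge is open in `restrict F ω` iff it is open in `ω` and belongs to `F`. -/
lemma restrict_eq_true_iff {F : Set E} [DecidablePred (· ∈ F)] {ω : Config E} {e : E} :
    restrict F ω e = true ↔ ω e = true ∧ e ∈ F := by
  simp [restrict]

/-- `restrict F ω ≤ ω`. -/
lemma restrict_le (F : Set E) [DecidablePred (· ∈ F)] (ω : Config E) : restrict F ω ≤ ω := by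
  intro e
  by_cases h : e ∈ F
  · rw [restrict_apply_of_mem h]
  · rw [restrict_apply_of_notMem h]
    exact Bool.false_le _

/-- `restrict F` only sees the edges of `F`. -/
lemma restrict_congr {F : Set E} [DecidablePred (· ∈ F)] {ω ω' : Config E}
    (h : ∀ e ∈ F, ω e = ω' e) : restrict F ω = restrict F ω' := by
  funext e
  by_cases he : e ∈ F
  · rw [restrict_apply_of_mem he, restrict_apply_of_mem he, h e he]
  · rw [restrict_apply_of_notMem he, restrict_apply_of_notMem he]

/-- An event defined through `restrict F` is determined by the edges of `F`. -/
lemma dependsOn_restrict (F : Set E) [DecidablePred (· ∈ F)] (P : Config E → Prop) :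
    DependsOn (· ∈ {ω | P (restrict F ω)}) F := by
  intro ω ω' h
  show P (restrict F ω) = P (restrict F ω')
  rw [restrict_congr h]

end Restrict

section Exploration

variable {V : Type*} {E : Type*}

/-- `S` is internally connected from `v`: `v ∈ S` and every `u ∈ S` is joined to `v` by open
edges lying inside `S`. -/
def internallyConnected (ends : E → Sym2 V) (v : V) (S : Set V)
    [DecidablePred (· ∈ within ends S)] : Set (Config E) :=
  {ω | v ∈ S ∧ ∀ u ∈ S, Conn ends (restrict (within ends S) ω) v u}

/-- All edges of the boundary `∂S` are closed. -/
def boundaryClosed (ends : E → Sym2 V) (S : Set V) : Set (Config E) :=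
  {ω | ∀ e ∈ boundary ends S, ω e = false}

/-- `internallyConnected` is determined by the edges inside `S`. -/
lemma dependsOn_internallyConnected (ends : E → Sym2 V) (v : V) (S : Set V)
    [DecidablePred (· ∈ within ends S)] :
    DependsOn (· ∈ internallyConnected ends v S) (within ends S) :=
  dependsOn_restrict (within ends S) fun ω' => v ∈ S ∧ ∀ u ∈ S, Conn ends ω' v u

/-- `boundaryClosed` is determined by the boundary edges. -/
lemma dependsOn_boundaryClosed (ends : E → Sym2 V) (S : Set V) :
    DependsOn (· ∈ boundaryClosed ends S) (boundary ends S) := by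
  intro ω ω' h
  show (∀ e ∈ boundary ends S, ω e = false) = ∀ e ∈ boundary ends S, ω' e = false
  exact propext (forall_congr' fun e => forall_congr' fun he => by rw [h e he])

/-- **Exploration identity**: `{C(v) = S} = {S internally connected from v} ∩ {∂S closed}`. -/
theorem clusterEvent_eq (ends : E → Sym2 V) (v : V) (S : Set V)
    [DecidablePred (· ∈ within ends S)] :
    clusterEvent ends v S = internallyConnected ends v S ∩ boundaryClosed ends S := by
  ext ω
  simp only [mem_clusterEvent, Set.mem_inter_iff, internallyConnected, boundaryClosed,
    Set.mem_setOf_eq]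
  constructor
  · intro hS
    have hvS : v ∈ S := hS ▸ mem_cluster_self ends ω v
    refine ⟨⟨hvS, fun u hu => ?_⟩, fun e he => ?_⟩
    · rw [← hS] at hu
      have key : u ∈ {x | x ∈ S ∧ Conn ends (restrict (within ends S) ω) v x} := by
        refine mem_of_conn_of_closed (ends := ends) (ω := ω) ?_ ⟨hvS, conn_refl _ _ _⟩ hu
        rintro x ⟨hxS, hxc⟩ y hxy
        obtain ⟨_, e, he, hends⟩ := openGraph_adj.1 hxy
        have hyS : y ∈ S := by
          rw [← hS] at hxS ⊢
          exact mem_cluster_of_adj hxS hxy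
        have he' : restrict (within ends S) ω e = true :=
          restrict_eq_true_iff.2 ⟨he, x, hxS, y, hyS, hends⟩
        exact ⟨hyS, conn_trans hxc (conn_of_openAdj ⟨e, he', hends⟩)⟩
      exact key.2
    · obtain ⟨x, hx, y, hy, hends⟩ := he
      by_contra hcon
      have hopen : ω e = true := by
        cases h : ω e
        · exact absurd h hcon
        · rfl
      apply hy
      rw [← hS] at hx ⊢
      exact conn_trans hx (conn_of_openAdj ⟨e, hopen, hends⟩)
  · rintro ⟨⟨hvS, hint⟩, hbd⟩
    apply Set.Subset.antisymm
    · intro u hu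
      refine mem_of_conn_of_closed (ends := ends) (ω := ω) ?_ hvS hu
      intro x hx y hxy
      obtain ⟨_, e, he, hends⟩ := openGraph_adj.1 hxy
      by_contra hy
      have := hbd e ⟨x, hx, y, hy, hends⟩
      rw [he] at this
      exact Bool.true_eq_false.mp this
    · intro u hu
      exact conn_mono (restrict_le _ ω) (hint u hu)

variable [Fintype E] [DecidableEq E] {R : Type*} [CommRing R]

/-- **Exploration factorisation**:
`P(C(v) = S) = P(S internally connected from v) · P(∂S closed)`. -/
theorem prob_clusterEvent_eq_mul (p : E → R) (ends : E → Sym2 V) (v : V) (S : Set V)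
    [DecidablePred (· ∈ within ends S)] :
    prob p (clusterEvent ends v S) =
      prob p (internallyConnected ends v S) * prob p (boundaryClosed ends S) := by
  rw [clusterEvent_eq]
  exact prob_inter_eq_mul_of_dependsOn p (disjoint_within_boundary ends S)
    (dependsOn_internallyConnected ends v S) (dependsOn_boundaryClosed ends S)

/-- `P(∂S closed) = ∏_{e ∈ ∂S} (1 - p e)`, for a `Finset` `B` enumerating the boundary. -/
theorem prob_boundaryClosed (p : E → R) (ends : E → Sym2 V) (S : Set V) (B : Finset E)
    (hB : ∀ e, e ∈ B ↔ e ∈ boundary ends S) :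
    prob p (boundaryClosed ends S) = ∏ e ∈ B, (1 - p e) := by
  have : boundaryClosed ends S = allClosed B := by
    ext ω
    simp only [boundaryClosed, Set.mem_setOf_eq, mem_allClosed, hB]
  rw [this, prob_allClosed]

/-- **Exploration factorisation, explicit form**:
`P(C(v) = S) = P(S internally connected from v) · ∏_{e ∈ ∂S} (1 - p e)`. -/
theorem prob_clusterEvent_eq_mul_prod (p : E → R) (ends : E → Sym2 V) (v : V) (S : Set V)
    [DecidablePred (· ∈ within ends S)] (B : Finset E) (hB : ∀ e, e ∈ B ↔ e ∈ boundary ends S) :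
    prob p (clusterEvent ends v S) =
      prob p (internallyConnected ends v S) * ∏ e ∈ B, (1 - p e) := by
  rw [prob_clusterEvent_eq_mul, prob_boundaryClosed p ends S B hB]

end Exploration

/-! ## Connections after exploring a cluster -/

section AfterExploration

variable {V : Type*} {E : Type*}

/-- On `{C(v) = S}`, for `u ∉ S` the connections of `u` only use edges not touching `S`. -/
lemma conn_restrict_iff_of_cluster_eq {ends : E → Sym2 V} {ω : Config E} {v : V} {S : Set V}
    [DecidablePred (· ∈ (touches ends S)ᶜ)] (hS : cluster ends ω v = S) {u w : V} (hu : u ∉ S) :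
    Conn ends (restrict (touches ends S)ᶜ ω) u w ↔ Conn ends ω u w := by
  constructor
  · exact conn_mono (restrict_le _ ω)
  · intro h
    have key : w ∈ {x | x ∉ S ∧ Conn ends (restrict (touches ends S)ᶜ ω) u x} := by
      refine mem_of_conn_of_closed (ends := ends) (ω := ω) ?_ ⟨hu, conn_refl _ _ _⟩ h
      rintro x ⟨hxS, hxc⟩ y hxy
      obtain ⟨_, e, he, hends⟩ := openGraph_adj.1 hxy
      have hyS : y ∉ S := by
        intro hy
        apply hxS
        rw [← hS] at hy ⊢
        exact conn_trans hy (conn_of_openAdj (OpenAdj.symm ⟨e, he, hends⟩))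
      have hnt : e ∉ touches ends S := by
        rintro ⟨x', hx', y', hends'⟩
        rw [hends, Sym2.eq_iff] at hends'
        rcases hends' with ⟨rfl, _⟩ | ⟨_, rfl⟩
        · exact hxS hx'
        · exact hyS hx'
      have he' : restrict (touches ends S)ᶜ ω e = true := restrict_eq_true_iff.2 ⟨he, hnt⟩
      exact ⟨hyS, conn_trans hxc (conn_of_openAdj ⟨e, he', hends⟩)⟩
    exact key.2

/-- On `{C(v) = S}` (`u ∉ S`), the event `{u ↔ w}` coincides with the connection event of the
graph with the edges touching `S` removed. -/
lemma clusterEvent_inter_connEvent (ends : E → Sym2 V) (v : V) (S : Set V)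
    [DecidablePred (· ∈ (touches ends S)ᶜ)] {u w : V} (hu : u ∉ S) :
    clusterEvent ends v S ∩ connEvent ends u w =
      clusterEvent ends v S ∩ {ω | Conn ends (restrict (touches ends S)ᶜ ω) u w} := by
  ext ω
  simp only [Set.mem_inter_iff, mem_clusterEvent, mem_connEvent, Set.mem_setOf_eq]
  constructor
  · rintro ⟨hS, h⟩
    exact ⟨hS, (conn_restrict_iff_of_cluster_eq hS hu).2 h⟩
  · rintro ⟨hS, h⟩
    exact ⟨hS, (conn_restrict_iff_of_cluster_eq hS hu).1 h⟩

variable [Fintype E] [DecidableEq E] {R : Type*} [CommRing R]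

/-- **Spatial Markov property for connections**: for `u ∉ S`,
`P(C(v) = S, u ↔ w) = P(C(v) = S) · P(u ↔ w in the graph with the edges touching S removed)`. -/
theorem prob_clusterEvent_inter_connEvent (p : E → R) (ends : E → Sym2 V) (v : V) (S : Set V)
    [DecidablePred (· ∈ (touches ends S)ᶜ)] {u w : V} (hu : u ∉ S) :
    prob p (clusterEvent ends v S ∩ connEvent ends u w) =
      prob p (clusterEvent ends v S) *
        prob p {ω | Conn ends (restrict (touches ends S)ᶜ ω) u w} := by
  rw [clusterEvent_inter_connEvent ends v S hu]
  exact prob_clusterEvent_inter_eq_mul p ends v S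
    (dependsOn_restrict (touches ends S)ᶜ fun ω' => Conn ends ω' u w) disjoint_compl_right

end AfterExploration

end Summit.Ventures.PercRepro2
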